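/-
Copyright: lit-balaban Phase-2 proof seat p30 (gen 9).  Statement-level skeleton of a published paper; no proof claims beyond what
the kernel checks below.
-/
import Literature.MathematicalPhysics.QuantumFieldTheory.BalabanImbrieJaffe1984to88.BIJ85Prop12TorusBridgePieces

/-!
# [BalabanImbrieJaffe1985] (7.2.2) ⇐ [6I] Prop. 1.2 — TRANSFER of (1.110), members `n = 0, 1`, to p09's carrier (file 3 of 5)

T. Bałaban, J. Imbrie, A. Jaffe, Commun. Math. Phys. **97** (1985) 299–329 [BalabanImbrieJaffe1985], Sect. 7.2 p. 325; T. Bałaban,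
Commun. Math. Phys. **95** (1984) 17–40 [Balaban1984PropagatorsI] = [6I], Prop. 1.2 (1.110) p. 35 and (1.118) p. 36.

From the (1.110) clauses `n = 0, 1` of `B5.Ineq110_114` for r02's REAL SETTING OF RECORD `latticeSettingP12R (L^k) (Mk P k) a K′` (real
sources `J_r`, G = Δ_a⁻¹ on `Tor (fine L^k Mk)`, corner-centred doubled cubes `Δ̃(y)`), the same clauses for p09's carrier
`settingOf (torusRep P k (deltaAData hk a))` (kernels `Gk hk a`, `DGk hk a`, centred open cubes `Δ̃′`, distances `|·|_∞/L^k`, `|·|_∞`):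
`sup_{Δ̃′(y)}|G_kJ| ≤ 6^d e^{3δ₀}C e^{−δ₀|y−y_J|_∞}|J|` (`e0_transfer`) and the same for `∇G_kJ` (`e1_transfer`), for `J` supported in `Δ̃′(y_J)`.
THE ARGUMENT (p. 36 with the printed partition of unity (1.118)): `J = Σ_{y″} J_{y″}` along `wP` (at most `6^d` non-zero pieces, all with
`|y″ − y_J|_∞ ≤ 2`, `BIJ85Prop12TorusBridgePieces`), `G_kJ = Σ G_kJ_{y″}`, each piece bounded by r02's (1.110) at the block `x_k` of the
evaluation point (`EK x ∈ Δ̃(x_k)`, `|x_k − y|_∞ ≤ 1`), exponents recombined by the triangle inequality; real parts through `Gk_mulVec_re`,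
`DGk_mulVec_re` and `|Re z| ≤ |z|`.
WHAT IS PROVED (0 `sorry`, theorems only, no `def`, no new named fact).  statement-level skeleton of published theorems with citation tags; proofs where landed; nothing here is a claim about the Yang–Mills mass gap.
Unit `lit-balaban-p30` (literature-prover-lit-balaban-p30-g9-0), 2026-08-21.
-/

open scoped BigOperators Matrix

namespace Literature.MathematicalPhysics.QuantumFieldTheory.BalabanImbrieJaffe1984to88.BIJ85Prop12TorusBridgeSup

open Balaban1983to89 hiding Site Plaq
open Balaban1983to89.LatticeFieldCalculus (supDist)
open Balaban1983to89.B3TorusRadialSums (supDist_comm)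
open Balaban1983to89.B5Eq118OneStroke (iterBlockOf)
open Balaban1983to89.B5Eq117TorusCarriers (Mk EK)
open Balaban1983to89.B5Prop11Plancherel (Tor fine)
open Balaban1983to89.B5Prop12FieldsLattice (distU distSite cubeT cubeB suppInL supNormL)
open Balaban1983to89.B5DeltaA169 (DeltaA)
open Balaban1983to89.LatticeNorms (supNorm supNorm_le norm_le_supNorm supNorm_nonneg)
open BIJ85Ineq722Proof BIJ85Ineq722ProofPart2 BIJ85Ineq722Torus BIJ85Ineq722DeltaA BIJ85Prop12TorusBridgeGeom BIJ85Prop12TorusBridgePieces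
-- inside this namespace the bare `Site` is the `ℤ^d` carrier of the QFT root; the torus one is renamed:
open Balaban1983to89 renaming Site → TSite

noncomputable section

variable {P : Params} {k : ℕ}

section Transfer

variable (hk : k ≤ P.m + P.K) (a : ℝ)

/-! ## §1  (1.110), member `n = 0`: `sup_{Δ̃′(y)} |G_kJ|` -/

/-- one piece at one point: `|(G_kJ_{y″})_μ(x)| ≤ C e^{−δ₀|x_k − y″|}|J|` from r02's (1.110) `n = 0` at the block `x_k` (`EK x ∈ Δ̃(x_k)`).
[cite: Balaban1984PropagatorsI, (1.110) p.35] -/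
theorem e0_piece_le {C δ₀ : ℝ} (hC : 0 ≤ C)
    (h0 : ∀ (Jr : Tor (fine (P.L ^ k) (Mk P k)) × Fin P.d → ℝ) (y y' : Tor (Mk P k)),
      suppInL (P.L ^ k) (Mk P k) (.vec fun b => (Jr b : ℂ)) y' →
      supNorm (cubeB (P.L ^ k) (Mk P k) y) ((DeltaA (P.L ^ k) (Mk P k) a)⁻¹ *ᵥ fun b => (Jr b : ℂ)) ≤
        C * Real.exp (-(δ₀ * distSite (Mk P k) y y')) * supNormL (P.L ^ k) (Mk P k) (.vec fun b => (Jr b : ℂ)))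
    (J : TSite P 0 × Fin P.d → ℝ) (y'' : TSite P k) (x : TSite P 0) (μ : Fin P.d) :
    |(Gk hk a *ᵥ pieceJ hk y'' J) (x, μ)| ≤ C * Real.exp (-(δ₀ * supDist (iterBlockOf k x) y'')) * ‖J‖ := by
  rw [Gk_mulVec_re]
  refine (Complex.abs_re_le_norm _).trans ?_
  have hmem : (EK hk x, μ) ∈ cubeB (P.L ^ k) (Mk P k) (iterBlockOf k x) :=
    Finset.mem_product.2 ⟨EK_mem_cubeT_blk hk x, Finset.mem_univ _⟩
  refine (norm_le_supNorm _ hmem).trans ?_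
  have h := h0 (trR hk (pieceJ hk y'' J)) (iterBlockOf k x) y'' (suppInL_pieceJ hk y'' J)
  rw [distSite_eq_supDist] at h
  rw [trC_eq]
  refine h.trans (mul_le_mul_of_nonneg_left ((supNormL_trC_le hk _).trans (norm_pieceJ_le hk y'' J)) ?_)
  exact mul_nonneg hC (Real.exp_nonneg _)

/-- **(1.110), `n = 0`, ON p09's CARRIER**: for `J` supported in the centred cube `Δ̃′(y_J)`,
`sup_{x ∈ Δ̃′(y)} |(G_kJ)_μ(x)| ≤ 6^d e^{3δ₀} C·e^{−δ₀|y − y_J|_∞}·|J|`. [cite: Balaban1984PropagatorsI, (1.110) p.35] -/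
theorem e0_transfer {C δ₀ : ℝ} (hC : 0 ≤ C) (hδ : 0 ≤ δ₀)
    (h0 : ∀ (Jr : Tor (fine (P.L ^ k) (Mk P k)) × Fin P.d → ℝ) (y y' : Tor (Mk P k)),
      suppInL (P.L ^ k) (Mk P k) (.vec fun b => (Jr b : ℂ)) y' →
      supNorm (cubeB (P.L ^ k) (Mk P k) y) ((DeltaA (P.L ^ k) (Mk P k) a)⁻¹ *ᵥ fun b => (Jr b : ℂ)) ≤
        C * Real.exp (-(δ₀ * distSite (Mk P k) y y')) * supNormL (P.L ^ k) (Mk P k) (.vec fun b => (Jr b : ℂ)))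
    (J : TSite P 0 × Fin P.d → ℝ) (y yJ : TSite P k) (hJ : ∀ i, J i ≠ 0 → i.1 ∈ (torusRep P k (deltaAData hk a)).cube yJ) :
    cubeSup (torusRep P k (deltaAData hk a)) (Gk hk a *ᵥ J) y ≤
      (6 ^ P.d * Real.exp (3 * δ₀) * C) * Real.exp (-(δ₀ * (supDist y yJ : ℝ))) * ‖J‖ := by
  classical
  set B := C * (Real.exp (3 * δ₀) * Real.exp (-(δ₀ * (supDist y yJ : ℝ)))) * ‖J‖ with hB
  have hB0 : 0 ≤ B := by positivity
  have hpt : ∀ (x : TSite P 0) (μ : Fin P.d), x ∈ (torusRep P k (deltaAData hk a)).cube y →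
      |(Gk hk a *ᵥ J) (x, μ)| ≤ (2 * 2 + 2) ^ P.d * B := by
    intro x μ hx
    have hsplit : (Gk hk a *ᵥ J) (x, μ) = ∑ y'' : TSite P k, (Gk hk a *ᵥ pieceJ hk y'' J) (x, μ) := by
      conv_lhs => rw [← sum_pieceJ hk J]
      rw [mulVec_finset_sum, Finset.sum_apply]
    rw [hsplit]
    refine abs_sum_ball_le _ yJ 2 hB0 (fun y'' hfar => ?_) (fun y'' hnear => ?_)
    · rw [pieceJ_eq_zero_of_far hk hJ hfar, Matrix.mulVec_zero, Pi.zero_apply]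
    · refine (e0_piece_le hk a hC h0 J y'' x μ).trans ?_
      rw [hB]
      refine mul_le_mul_of_nonneg_right (mul_le_mul_of_nonneg_left ?_ hC) (norm_nonneg _)
      apply exp_le_of_triangle hδ
      have d1 := supDist_blk_le_of_mem_cube hk hx
      have t1 := supDist_triangle y (iterBlockOf k x) yJ
      have t2 := supDist_triangle (iterBlockOf k x) y'' yJ
      rw [supDist_comm y (iterBlockOf k x)] at t1
      have : (supDist y yJ : ℝ) ≤ (1 : ℕ) + (supDist (iterBlockOf k x) y'' : ℝ) + (2 : ℕ) := by
        exact_mod_cast (by omega : supDist y yJ ≤ 1 + supDist (iterBlockOf k x) y'' + 2)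
      push_cast at this
      linarith
  unfold cubeSup
  rw [pi_norm_le_iff_of_nonneg (by positivity)]
  intro i
  split_ifs with hi
  · rw [Real.norm_eq_abs]
    refine (hpt i.1 i.2 hi).trans (le_of_eq ?_)
    rw [hB]; norm_num; ring
  · rw [norm_zero]; positivity

/-! ## §2  (1.110), member `n = 1`: `sup_{Δ̃′(y)} |∇G_kJ|` -/

/-- one piece at one point: `|(∇G_kJ_{y″})_{λμ}(x)| ≤ C e^{−δ₀|x_k − y″|}|J|` from r02's (1.110) `n = 1` at the block `x_k`.
[cite: Balaban1984PropagatorsI, (1.110) p.35] -/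
theorem e1_piece_le {C δ₀ : ℝ} (hC : 0 ≤ C)
    (h1 : ∀ (Jr : Tor (fine (P.L ^ k) (Mk P k)) × Fin P.d → ℝ) (y y' : Tor (Mk P k)),
      suppInL (P.L ^ k) (Mk P k) (.vec fun b => (Jr b : ℂ)) y' →
      supNorm (Finset.univ ×ˢ cubeB (P.L ^ k) (Mk P k) y)
        (fun p : Fin P.d × (Tor (fine (P.L ^ k) (Mk P k)) × Fin P.d) =>
          B5Prop11Lattice.grad (P.L ^ k) (Mk P k) ((DeltaA (P.L ^ k) (Mk P k) a)⁻¹ *ᵥ fun b => (Jr b : ℂ)) p.1 p.2) ≤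
        C * Real.exp (-(δ₀ * distSite (Mk P k) y y')) * supNormL (P.L ^ k) (Mk P k) (.vec fun b => (Jr b : ℂ)))
    (J : TSite P 0 × Fin P.d → ℝ) (y'' : TSite P k) (x : TSite P 0) (lam μ : Fin P.d) :
    |(DGk hk a *ᵥ pieceJ hk y'' J) (x, lam, μ)| ≤ C * Real.exp (-(δ₀ * supDist (iterBlockOf k x) y'')) * ‖J‖ := by
  rw [DGk_mulVec_re, trC_eq]
  refine (Complex.abs_re_le_norm _).trans ?_
  have hmem : (lam, (EK hk x, μ)) ∈ Finset.univ ×ˢ cubeB (P.L ^ k) (Mk P k) (iterBlockOf k x) :=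
    Finset.mem_product.2 ⟨Finset.mem_univ _, Finset.mem_product.2 ⟨EK_mem_cubeT_blk hk x, Finset.mem_univ _⟩⟩
  have hn := norm_le_supNorm (fun p : Fin P.d × (Tor (fine (P.L ^ k) (Mk P k)) × Fin P.d) =>
    B5Prop11Lattice.grad (P.L ^ k) (Mk P k) ((DeltaA (P.L ^ k) (Mk P k) a)⁻¹ *ᵥ fun b =>
      (trR hk (pieceJ hk y'' J) b : ℂ)) p.1 p.2) hmem
  refine hn.trans ?_
  have h := h1 (trR hk (pieceJ hk y'' J)) (iterBlockOf k x) y'' (suppInL_pieceJ hk y'' J)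
  rw [distSite_eq_supDist] at h
  exact h.trans (mul_le_mul_of_nonneg_left ((supNormL_trC_le hk _).trans (norm_pieceJ_le hk y'' J))
    (mul_nonneg hC (Real.exp_nonneg _)))

/-- **(1.110), `n = 1`, ON p09's CARRIER**: for `J` supported in the centred cube `Δ̃′(y_J)`,
`sup_{x ∈ Δ̃′(y), λ, μ} |(∇G_kJ)_{λμ}(x)| ≤ 6^d e^{3δ₀} C·e^{−δ₀|y − y_J|_∞}·|J|`. [cite: Balaban1984PropagatorsI, (1.110) p.35] -/
theorem e1_transfer {C δ₀ : ℝ} (hC : 0 ≤ C) (hδ : 0 ≤ δ₀)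
    (h1 : ∀ (Jr : Tor (fine (P.L ^ k) (Mk P k)) × Fin P.d → ℝ) (y y' : Tor (Mk P k)),
      suppInL (P.L ^ k) (Mk P k) (.vec fun b => (Jr b : ℂ)) y' →
      supNorm (Finset.univ ×ˢ cubeB (P.L ^ k) (Mk P k) y)
        (fun p : Fin P.d × (Tor (fine (P.L ^ k) (Mk P k)) × Fin P.d) =>
          B5Prop11Lattice.grad (P.L ^ k) (Mk P k) ((DeltaA (P.L ^ k) (Mk P k) a)⁻¹ *ᵥ fun b => (Jr b : ℂ)) p.1 p.2) ≤
        C * Real.exp (-(δ₀ * distSite (Mk P k) y y')) * supNormL (P.L ^ k) (Mk P k) (.vec fun b => (Jr b : ℂ)))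
    (J : TSite P 0 × Fin P.d → ℝ) (y yJ : TSite P k) (hJ : ∀ i, J i ≠ 0 → i.1 ∈ (torusRep P k (deltaAData hk a)).cube yJ) :
    cubeSupG (torusRep P k (deltaAData hk a)) (DGk hk a *ᵥ J) y ≤
      (6 ^ P.d * Real.exp (3 * δ₀) * C) * Real.exp (-(δ₀ * (supDist y yJ : ℝ))) * ‖J‖ := by
  classical
  set B := C * (Real.exp (3 * δ₀) * Real.exp (-(δ₀ * (supDist y yJ : ℝ)))) * ‖J‖ with hB
  have hB0 : 0 ≤ B := by positivity
  have hpt : ∀ (x : TSite P 0) (lam μ : Fin P.d), x ∈ (torusRep P k (deltaAData hk a)).cube y →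
      |(DGk hk a *ᵥ J) (x, lam, μ)| ≤ (2 * 2 + 2) ^ P.d * B := by
    intro x lam μ hx
    have hsplit : (DGk hk a *ᵥ J) (x, lam, μ) = ∑ y'' : TSite P k, (DGk hk a *ᵥ pieceJ hk y'' J) (x, lam, μ) := by
      conv_lhs => rw [← sum_pieceJ hk J]
      rw [mulVec_finset_sum, Finset.sum_apply]
    rw [hsplit]
    refine abs_sum_ball_le _ yJ 2 hB0 (fun y'' hfar => ?_) (fun y'' hnear => ?_)
    · rw [pieceJ_eq_zero_of_far hk hJ hfar, Matrix.mulVec_zero, Pi.zero_apply]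
    · refine (e1_piece_le hk a hC h1 J y'' x lam μ).trans ?_
      rw [hB]
      refine mul_le_mul_of_nonneg_right (mul_le_mul_of_nonneg_left ?_ hC) (norm_nonneg _)
      apply exp_le_of_triangle hδ
      have d1 := supDist_blk_le_of_mem_cube hk hx
      have t1 := supDist_triangle y (iterBlockOf k x) yJ
      have t2 := supDist_triangle (iterBlockOf k x) y'' yJ
      rw [supDist_comm y (iterBlockOf k x)] at t1
      have : (supDist y yJ : ℝ) ≤ (1 : ℕ) + (supDist (iterBlockOf k x) y'' : ℝ) + (2 : ℕ) := by
        exact_mod_cast (by omega : supDist y yJ ≤ 1 + supDist (iterBlockOf k x) y'' + 2)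
      push_cast at this
      linarith
  unfold cubeSupG
  rw [pi_norm_le_iff_of_nonneg (by positivity)]
  intro g
  split_ifs with hg
  · rw [Real.norm_eq_abs]
    refine (hpt g.1 g.2.1 g.2.2 hg).trans (le_of_eq ?_)
    rw [hB]; norm_num; ring
  · rw [norm_zero]; positivity

end Transfer

end

end Literature.MathematicalPhysics.QuantumFieldTheory.BalabanImbrieJaffe1984to88.BIJ85Prop12TorusBridgeSup
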